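import Summits.CriticalPhenomena.CardyFormulaZ2.Theorems.CardyFlipRussoVoronoiHubFromSmirnovStubMeckeRussoPrelims
import Literature.Topology.PlaneTopology.JordanDomainLocalJoin
import Mathlib.MeasureTheory.Measure.Haar.NormedSpace
import Mathlib.MeasureTheory.Measure.Lebesgue.VolumeOfBalls

/-!
# The far field of the Ward integral (line `moebius-exact-delaunay-dilation-ward`, toward S2′ `stub_wardBound`)
# (crux `VoronoiHubFromSmirnov`, stmt-CriticalPhenomena-6433)

The Ward kernel S2′ (`Sig.stub_wardBound`, Benjamini–Schramm's density-invariance conjecture in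
differential form) asks that the annealed insertion response `insResp ρ t R δ` integrate to `o(1)`
against every rescaled test weight `w (δ z)`, uniformly in `t ∈ [0,1]`.  `wardIntegral_farField`
proves the NON-conjectural part: weights supported at positive distance `d₀` from `closure Ω`
contribute `O(δ²)`.  Cover the compact `closure Ω` by finitely many balls `B(vᵢ, d₀/2)`; if every
rescaled ball `B(vᵢ/δ, d₀/(2δ))` contains a nucleus of `c.1`, then for `z' ∈ closure Ω` some nucleus
is closer to `z'/δ` than any `z` with `δ z ∈ tsupport w` (`exists_mem_dist_le_of_cover`), so
inserting `z` changes neither `infDist (z'/δ) c.1` on `closure Ω` (`infDist_insertAt_eq`) nor the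
crossing event (`insertFst_mem_crossEvent_iff`); likewise for white insertions.  Hence
`|insResp| ≤ 2 ∑ᵢ P{N(B(vᵢ/δ, d₀/(2δ))) = 0}` (`abs_measureReal_sub_le_of_iff` — outer-measure
monotonicity, no measurability of the crossing event is used); each void probability is
`exp (-a/δ²) ≤ 2δ⁴/a²` by `measureReal_count_eq_zero` and `ρ_t ≥ min 1 (inf ρ) > 0`, while
`∫ |w (δ z)| dz = δ⁻² ∫ |w|` (`Measure.integral_comp_smul`).  No new definitions.
(Benjamini–Schramm 1998 §10 for the context; Last–Penrose 2017 Ch. 3 for void probabilities.)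
-/

noncomputable section

namespace Summit.CriticalPhenomena.CardyFormulaZ2.Cruxes.VoronoiHubFromSmirnov.MoebiusExactDelaunayDilationWard

open scoped Topology ENNReal Interval
open Filter Set MeasureTheory Metric
open Literature.Analysis.FunctionSpaces
open Literature.Probability.RandomPlanarGeometry
open Literature.Topology.PlaneTopology

/-! ### Geometry: far insertions do not change the black region near `closure Ω` -/

/-- Inserting a nucleus `z` that is not closer to `p` than some old nucleus `q ∈ c` does not
change the distance from `p` to the configuration. [folklore] -/
theorem infDist_insertAt_eq {p z : ℂ} {c : PointConfig ℂ} (h : ∃ q ∈ c, dist p q ≤ dist p z) :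
    infDist p (insertAt z c : Set ℂ) = infDist p (c : Set ℂ) := by
  obtain ⟨q, hq, hqz⟩ := h
  have hne : (c : Set ℂ).Nonempty := ⟨q, hq⟩
  have hsub : (c : Set ℂ) ⊆ (insertAt z c : Set ℂ) := fun y hy => mem_insertAt.2 (Or.inl hy)
  refine le_antisymm (infDist_le_infDist_of_subset hsub hne) ((le_infDist (hne.mono hsub)).2 ?_)
  intro y hy
  rcases mem_insertAt.1 hy with hy | rfl
  · exact infDist_le_dist_of_mem hy
  · exact (infDist_le_dist_of_mem hq).trans hqz

/-- If for every `z' ∈ closure Ω` some black nucleus is at least as close to `z'/δ` as `z`, then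
inserting a BLACK nucleus at `z` does not change membership in the crossing event: the closed black
region is unchanged on `closure Ω`. [folklore] -/
theorem insertFst_mem_crossEvent_iff {R : ConformalRectangle} {δ : ℝ} {z : ℂ}
    {c : PointConfig ℂ × PointConfig ℂ}
    (h : ∀ z' ∈ closure R.carrier, ∃ q ∈ c.1, dist (z' / (δ : ℂ)) q ≤ dist (z' / (δ : ℂ)) z) :
    (insertAt z c.1, c.2) ∈ crossEvent R δ ↔ c ∈ crossEvent R δ := by
  have hset : closure R.carrier ∩ {z' | infDist (z' / (δ : ℂ)) (insertAt z c.1 : Set ℂ) ≤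
      infDist (z' / (δ : ℂ)) (c.2 : Set ℂ)} = closure R.carrier ∩
      {z' | infDist (z' / (δ : ℂ)) (c.1 : Set ℂ) ≤ infDist (z' / (δ : ℂ)) (c.2 : Set ℂ)} := by
    ext z'
    simp only [mem_inter_iff, mem_setOf_eq]
    constructor
    · rintro ⟨h1, h2⟩
      exact ⟨h1, by rwa [← infDist_insertAt_eq (h z' h1)]⟩
    · rintro ⟨h1, h2⟩
      exact ⟨h1, by rwa [infDist_insertAt_eq (h z' h1)]⟩
  simp only [crossEvent, mem_setOf_eq]
  rw [hset]

/-- If for every `z' ∈ closure Ω` some white nucleus is at least as close to `z'/δ` as `z`, then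
inserting a WHITE nucleus at `z` does not change membership in the crossing event. [folklore] -/
theorem insertSnd_mem_crossEvent_iff {R : ConformalRectangle} {δ : ℝ} {z : ℂ}
    {c : PointConfig ℂ × PointConfig ℂ}
    (h : ∀ z' ∈ closure R.carrier, ∃ q ∈ c.2, dist (z' / (δ : ℂ)) q ≤ dist (z' / (δ : ℂ)) z) :
    (c.1, insertAt z c.2) ∈ crossEvent R δ ↔ c ∈ crossEvent R δ := by
  have hset : closure R.carrier ∩ {z' | infDist (z' / (δ : ℂ)) (c.1 : Set ℂ) ≤
      infDist (z' / (δ : ℂ)) (insertAt z c.2 : Set ℂ)} = closure R.carrier ∩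
      {z' | infDist (z' / (δ : ℂ)) (c.1 : Set ℂ) ≤ infDist (z' / (δ : ℂ)) (c.2 : Set ℂ)} := by
    ext z'
    simp only [mem_inter_iff, mem_setOf_eq]
    constructor
    · rintro ⟨h1, h2⟩
      exact ⟨h1, by rwa [← infDist_insertAt_eq (h z' h1)]⟩
    · rintro ⟨h1, h2⟩
      exact ⟨h1, by rwa [infDist_insertAt_eq (h z' h1)]⟩
  simp only [crossEvent, mem_setOf_eq]
  rw [hset]

/-- **The cover argument.**  Let `K ⊆ ⋃_{v ∈ T} B(v, d₀/2)` and let `S` be at distance `≥ d₀` from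
`K`.  If every rescaled ball `B(v/δ, d₀/(2δ))`, `v ∈ T`, contains a nucleus of `c` and `δ z ∈ S`, then
for every `z' ∈ K` some nucleus of `c` is closer to `z'/δ` than `z` (distance `< d₀/δ ≤ dist`).
[folklore] -/
theorem exists_mem_dist_le_of_cover {K S : Set ℂ} {d₀ δ : ℝ} (hδ : 0 < δ)
    (hd : ∀ k ∈ K, ∀ s ∈ S, d₀ ≤ dist k s) {T : Finset ℂ}
    (hT : K ⊆ ⋃ v ∈ T, ball v (d₀ / 2)) {z : ℂ} (hz : (δ : ℂ) * z ∈ S) {c : PointConfig ℂ}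
    (hc : ∀ v ∈ T, c.count (ball (v / (δ : ℂ)) (d₀ / (2 * δ))) ≠ 0) :
    ∀ z' ∈ K, ∃ q ∈ c, dist (z' / (δ : ℂ)) q ≤ dist (z' / (δ : ℂ)) z := by
  intro z' hz'
  obtain ⟨v, hv, hzv⟩ := mem_iUnion₂.1 (hT hz')
  obtain ⟨q, hq⟩ : (c.carrier ∩ ball (v / (δ : ℂ)) (d₀ / (2 * δ))).Nonempty :=
    Set.encard_ne_zero.1 (hc v hv)
  refine ⟨q, hq.1, ?_⟩
  have hδc : ‖(δ : ℂ)‖ = δ := Complex.norm_of_nonneg hδ.le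
  have hδ0 : (δ : ℂ) ≠ 0 := Complex.ofReal_ne_zero.2 hδ.ne'
  have h1 : dist (z' / (δ : ℂ)) (v / (δ : ℂ)) = dist z' v / δ := by
    rw [dist_eq_norm, dist_eq_norm, ← sub_div, norm_div, hδc]
  have h2 : dist z' ((δ : ℂ) * z) = δ * dist (z' / (δ : ℂ)) z := by
    conv_lhs => rw [← mul_div_cancel₀ z' hδ0]
    rw [dist_eq_norm, dist_eq_norm, ← mul_sub, norm_mul, hδc]
  have h3 : dist (z' / (δ : ℂ)) (v / (δ : ℂ)) < d₀ / 2 / δ := by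
    rw [h1]; exact div_lt_div_of_pos_right (mem_ball.1 hzv) hδ
  have h4 : dist (v / (δ : ℂ)) q < d₀ / (2 * δ) := by rw [dist_comm]; exact mem_ball.1 hq.2
  have h5 : d₀ / 2 / δ + d₀ / (2 * δ) = d₀ / δ := by field_simp; ring
  have h6 : dist (z' / (δ : ℂ)) q < d₀ / δ :=
    calc dist (z' / (δ : ℂ)) q
        ≤ dist (z' / (δ : ℂ)) (v / (δ : ℂ)) + dist (v / (δ : ℂ)) q := dist_triangle _ _ _
      _ < d₀ / 2 / δ + d₀ / (2 * δ) := add_lt_add h3 h4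
      _ = d₀ / δ := h5
  have h7 : d₀ / δ ≤ dist (z' / (δ : ℂ)) z := by
    rw [div_le_iff₀ hδ, mul_comm, ← h2]; exact hd z' hz' _ hz
  exact (h6.trans_le h7).le

/-! ### Probability: agreement off a bad event, void events of the two marginals -/

/-- If two events agree off a bad event `B`, their probabilities differ by at most that of `B`
(outer-measure monotonicity and subadditivity: no measurability is needed). [folklore] -/
theorem abs_measureReal_sub_le_of_iff {α : Type*} [MeasurableSpace α] (μ : Measure α)
    [IsFiniteMeasure μ] (A E B : Set α) (h : ∀ x, x ∉ B → (x ∈ A ↔ x ∈ E)) :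
    |μ.real A - μ.real E| ≤ μ.real B := by
  have hAE : A ⊆ E ∪ B := fun x hx => by
    by_cases hB : x ∈ B
    · exact Or.inr hB
    · exact Or.inl ((h x hB).1 hx)
  have hEA : E ⊆ A ∪ B := fun x hx => by
    by_cases hB : x ∈ B
    · exact Or.inr hB
    · exact Or.inl ((h x hB).2 hx)
  have h1 : μ.real A ≤ μ.real E + μ.real B :=
    (measureReal_mono hAE (measure_ne_top μ _)).trans (measureReal_union_le _ _)
  have h2 : μ.real E ≤ μ.real A + μ.real B :=
    (measureReal_mono hEA (measure_ne_top μ _)).trans (measureReal_union_le _ _)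
  rw [abs_sub_le_iff]
  constructor <;> linarith

/-- Void probability of the BLACK marginal of `lawBW μ`: `P{N₁(B) = 0} = exp (-μ B)`. [folklore] -/
theorem lawBW_real_countFst_eq_zero {μ : Measure ℂ} (hP : IsPoissonPointProcess μ (poissonLaw μ))
    {B : Set ℂ} (hB : MeasurableSet B) (hμB : μ B ≠ ∞) :
    (lawBW μ).real {c : PointConfig ℂ × PointConfig ℂ | c.1.count B = 0} =
      Real.exp (-(μ B).toReal) := by
  haveI := hP.isProbabilityMeasure
  have hset : {c : PointConfig ℂ × PointConfig ℂ | c.1.count B = 0} =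
      {c₁ : PointConfig ℂ | c₁.count B = 0} ×ˢ (univ : Set (PointConfig ℂ)) := by
    ext c
    simp only [mem_setOf_eq, mem_prod, mem_univ, and_true]
  rw [hset, lawBW, measureReal_prod_prod, probReal_univ, mul_one,
    hP.measureReal_count_eq_zero hB hμB]

/-- Void probability of the WHITE marginal of `lawBW μ`: `P{N₂(B) = 0} = exp (-μ B)`. [folklore] -/
theorem lawBW_real_countSnd_eq_zero {μ : Measure ℂ} (hP : IsPoissonPointProcess μ (poissonLaw μ))
    {B : Set ℂ} (hB : MeasurableSet B) (hμB : μ B ≠ ∞) :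
    (lawBW μ).real {c : PointConfig ℂ × PointConfig ℂ | c.2.count B = 0} =
      Real.exp (-(μ B).toReal) := by
  haveI := hP.isProbabilityMeasure
  have hset : {c : PointConfig ℂ × PointConfig ℂ | c.2.count B = 0} =
      (univ : Set (PointConfig ℂ)) ×ˢ {c₂ : PointConfig ℂ | c₂.count B = 0} := by
    ext c
    simp only [mem_setOf_eq, mem_prod, mem_univ, true_and]
  rw [hset, lawBW, measureReal_prod_prod, probReal_univ, one_mul,
    hP.measureReal_count_eq_zero hB hμB]

/-! ### The intensity along the density path is bounded below -/

/-- Along the linear path, `ρ_t = 1 + t (ρ - 1) ≥ min 1 m` on `[0,1]` whenever `ρ ≥ m`. [folklore] -/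
theorem min_le_densityPath {ρ : ℂ → ℝ} {m : ℝ} (hm : ∀ x, m ≤ ρ x) {t : ℝ} (ht : t ∈ Icc (0:ℝ) 1)
    (x : ℂ) : min 1 m ≤ densityPath ρ t x := by
  unfold densityPath
  rcases le_or_gt 1 (ρ x) with h | h
  · have h0 : 0 ≤ t * (ρ x - 1) := mul_nonneg ht.1 (sub_nonneg.2 h)
    linarith [min_le_left (1:ℝ) m]
  · have key : 0 ≤ (1 - t) * (1 - ρ x) := mul_nonneg (sub_nonneg.2 ht.2) (sub_nonneg.2 h.le)
    linarith [min_le_right (1:ℝ) m, hm x]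

/-- An admissible profile is bounded below by a positive constant (it is continuous, positive and
equal to `1` off a compact set). [folklore] -/
theorem AdmissibleDensity.exists_pos_forall_le {ρ : ℂ → ℝ} (hρ : AdmissibleDensity ρ) :
    ∃ m, 0 < m ∧ ∀ x, m ≤ ρ x := by
  have hms : HasCompactMulSupport ρ := by
    have h1 : Function.mulSupport ρ = Function.support fun x => ρ x - 1 := by
      ext x
      simp only [Function.mem_mulSupport, Function.mem_support, ne_eq, sub_eq_zero]
    show IsCompact (closure (Function.mulSupport ρ))
    rw [h1]
    exact hρ.2.1
  obtain ⟨x₀, hx₀⟩ := hρ.continuous.exists_forall_le_of_hasCompactMulSupport hms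
  exact ⟨ρ x₀, hρ.2.2 x₀, hx₀⟩

/-- A uniform lower bound `m₀ ≤ ρ_t` makes `m₀ · volume ≤ intensity ρ t δ`. [folklore] -/
theorem ofReal_mul_volume_le_intensity {ρ : ℂ → ℝ} {t m₀ : ℝ} (hm : ∀ x, m₀ ≤ densityPath ρ t x)
    (δ : ℝ) {B : Set ℂ} (hB : MeasurableSet B) :
    ENNReal.ofReal m₀ * volume B ≤ intensity ρ t δ B := by
  rw [intensity, withDensity_apply _ hB, ← setLIntegral_const]
  exact lintegral_mono fun x => ENNReal.ofReal_le_ofReal (hm _)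

/-- The (real) area of a complex disc: `π r²`. [folklore] -/
theorem volume_real_complex_ball (a : ℂ) {r : ℝ} (hr : 0 ≤ r) :
    (volume (ball a r)).toReal = Real.pi * r ^ 2 := by
  rw [Complex.volume_ball, ENNReal.toReal_mul, ENNReal.toReal_pow, ENNReal.toReal_ofReal hr,
    ENNReal.coe_toReal, NNReal.coe_real_pi, mul_comm]

/-! ### The far field of the Ward integral -/

/-- **The far field is blind.**  For an admissible profile `ρ`, a test weight `w` whose support is
disjoint from `closure Ω`, and every `ε > 0`: eventually as `δ → 0⁺`, uniformly in `t ∈ [0,1]`,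
`|∫ w (δ z) · insResp ρ t R δ z dz| ≤ ε`.  (An insertion at physical distance `≥ d₀` from
`closure Ω` changes the black region on `closure Ω` only if one of finitely many balls of radius
`d₀/(2δ)` is void of nuclei — probability `≤ N exp (-a/δ²)` — while the weight has mass `δ⁻² ∫ |w|`.)
The special case of the kernel `Sig.stub_wardBound` with weights supported off `closure Ω`;
no measurability of the crossing event is needed. [folklore] -/
theorem wardIntegral_farField : ∀ ρ, AdmissibleDensity ρ → ∀ w, TestWeight w → ∀ R : ConformalRectangle, Disjoint (tsupport w) (closure R.carrier) → ∀ ε > (0:ℝ), ∀ᶠ δ : ℝ in 𝓝[>] 0, ∀ t ∈ Icc (0:ℝ) 1, |∫ z, w ((δ : ℂ) * z) * insResp ρ t R δ z| ≤ ε := by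
  intro ρ hρ w hw R hdisj ε hε
  have hρc : Continuous ρ := hρ.continuous
  -- a positive lower bound for the density along the path
  obtain ⟨m, hm0, hm⟩ := hρ.exists_pos_forall_le
  have hm₀ : 0 < min 1 m := lt_min one_pos hm0
  have hmd : ∀ t ∈ Icc (0:ℝ) 1, ∀ x, min 1 m ≤ densityPath ρ t x :=
    fun t ht x => min_le_densityPath hm ht x
  -- the separation `d₀` and the finite cover of `closure Ω`
  have hK : IsCompact (closure R.carrier) := R.isBounded.isCompact_closure
  obtain ⟨d₀, hd₀, hd⟩ : ∃ d₀ > 0, ∀ k ∈ closure R.carrier, ∀ s ∈ tsupport w, d₀ ≤ dist k s :=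
    exists_pos_forall_le_dist hK (isClosed_tsupport w) hdisj.symm
  obtain ⟨T, hT⟩ : ∃ T : Finset ℂ, closure R.carrier ⊆ ⋃ v ∈ T, ball v (d₀ / 2) :=
    hK.elim_finite_subcover (fun v : ℂ => ball v (d₀ / 2)) (fun _ => isOpen_ball)
      fun x _ => mem_iUnion.2 ⟨x, mem_ball_self (half_pos hd₀)⟩
  -- the constants
  set I : ℝ := ∫ y, |w y| with hIdef
  have hI : 0 ≤ I := integral_nonneg fun _ => abs_nonneg _
  set a : ℝ := min 1 m * Real.pi * d₀ ^ 2 / 4 with hadef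
  have ha : 0 < a := by positivity
  have hane : a ≠ 0 := ha.ne'
  set C : ℝ := 4 * (T.card : ℝ) * I / a ^ 2 with hCdef
  have hC : 0 ≤ C := by positivity
  obtain ⟨η, hη, hηC⟩ : ∃ η > 0, ∀ δ : ℝ, 0 < δ → δ < η → C * δ ^ 2 ≤ ε := by
    refine ⟨min 1 (ε / (C + 1)), lt_min one_pos (div_pos hε (by linarith)), fun δ hδ hδη => ?_⟩
    have hδδ : δ * δ < δ * 1 := mul_lt_mul_of_pos_left (hδη.trans_le (min_le_left _ _)) hδ
    have hδsq : δ ^ 2 ≤ ε / (C + 1) := by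
      rw [sq]; linarith [hδη.trans_le (min_le_right _ _)]
    calc C * δ ^ 2 ≤ C * (ε / (C + 1)) := mul_le_mul_of_nonneg_left hδsq hC
      _ ≤ ε := by
          rw [mul_div_assoc', div_le_iff₀ (by linarith : (0:ℝ) < C + 1)]
          nlinarith
  filter_upwards [Ioo_mem_nhdsGT hη] with δ hδI t ht
  obtain ⟨hδ, hδη⟩ := hδI
  have hδne : δ ≠ 0 := hδ.ne'
  -- the Poisson environment at `(t, δ)`
  have hP : IsPoissonPointProcess (intensity ρ t δ) (poissonLaw (intensity ρ t δ)) :=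
    isPoissonPointProcess_poissonLaw_intensity ρ hρc t δ
  haveI hMprob : IsProbabilityMeasure (lawBW (intensity ρ t δ)) :=
    isProbabilityMeasure_lawBW_intensity ρ hρc t δ
  haveI hνlf : IsLocallyFiniteMeasure (intensity ρ t δ) := by
    unfold intensity
    exact IsLocallyFiniteMeasure.withDensity_ofReal (continuous_densityPath_mul ρ hρc t δ)
  have hfin : ∀ v : ℂ, (intensity ρ t δ) (ball (v / (δ : ℂ)) (d₀ / (2 * δ))) ≠ ∞ :=
    fun v => measure_ball_ne_top
  -- void probabilities are super-exponentially small
  set Vb : ℝ := 2 * δ ^ 4 / a ^ 2 with hVbdef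
  have hvoid : ∀ v : ℂ,
      Real.exp (-((intensity ρ t δ) (ball (v / (δ : ℂ)) (d₀ / (2 * δ)))).toReal) ≤ Vb := by
    intro v
    have hle := ofReal_mul_volume_le_intensity (hmd t ht) δ
      (measurableSet_ball : MeasurableSet (ball (v / (δ : ℂ)) (d₀ / (2 * δ))))
    have hre : min 1 m * (Real.pi * (d₀ / (2 * δ)) ^ 2) ≤
        ((intensity ρ t δ) (ball (v / (δ : ℂ)) (d₀ / (2 * δ)))).toReal := by
      have h := ENNReal.toReal_mono (hfin v) hle
      rwa [ENNReal.toReal_mul, ENNReal.toReal_ofReal hm₀.le,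
        volume_real_complex_ball _ (by positivity)] at h
    have hL : min 1 m * (Real.pi * (d₀ / (2 * δ)) ^ 2) = a / δ ^ 2 := by
      rw [hadef]; field_simp; ring
    -- `exp (-L) ≤ 2 / L²` for `L = a/δ² > 0`, from `1 + L + L²/2 ≤ exp L`
    have hq := Real.quadratic_le_exp_of_nonneg (by positivity : (0:ℝ) ≤ a / δ ^ 2)
    have haδ : 0 < a / δ ^ 2 := by positivity
    calc Real.exp (-((intensity ρ t δ) (ball (v / (δ : ℂ)) (d₀ / (2 * δ)))).toReal)
        ≤ Real.exp (-(a / δ ^ 2)) := Real.exp_le_exp.2 (by rw [← hL]; linarith)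
      _ ≤ ((a / δ ^ 2) ^ 2 / 2)⁻¹ := by
          rw [Real.exp_neg]; exact inv_anti₀ (by positivity) (by linarith)
      _ = Vb := by rw [hVbdef]; field_simp
  -- pointwise bound on the insertion response at far insertion points
  set P : ℝ := 2 * ((T.card : ℝ) * Vb) with hPdef
  have hins : ∀ z : ℂ, (δ : ℂ) * z ∈ tsupport w → |insResp ρ t R δ z| ≤ P := by
    intro z hz
    set BAD₁ : Set (PointConfig ℂ × PointConfig ℂ) :=
      ⋃ v ∈ T, {c : PointConfig ℂ × PointConfig ℂ |
        c.1.count (ball (v / (δ : ℂ)) (d₀ / (2 * δ))) = 0} with hBAD₁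
    set BAD₂ : Set (PointConfig ℂ × PointConfig ℂ) :=
      ⋃ v ∈ T, {c : PointConfig ℂ × PointConfig ℂ |
        c.2.count (ball (v / (δ : ℂ)) (d₀ / (2 * δ))) = 0} with hBAD₂
    have hgood₁ : ∀ c : PointConfig ℂ × PointConfig ℂ, c ∉ BAD₁ →
        (c ∈ {c : PointConfig ℂ × PointConfig ℂ | (insertAt z c.1, c.2) ∈ crossEvent R δ} ↔
          c ∈ crossEvent R δ) := fun c hc => by
      rw [mem_setOf_eq]
      exact insertFst_mem_crossEvent_iff (exists_mem_dist_le_of_cover hδ hd hT hz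
        fun v hv h0 => hc (mem_iUnion₂.2 ⟨v, hv, h0⟩))
    have hgood₂ : ∀ c : PointConfig ℂ × PointConfig ℂ, c ∉ BAD₂ →
        (c ∈ {c : PointConfig ℂ × PointConfig ℂ | (c.1, insertAt z c.2) ∈ crossEvent R δ} ↔
          c ∈ crossEvent R δ) := fun c hc => by
      rw [mem_setOf_eq]
      exact insertSnd_mem_crossEvent_iff (exists_mem_dist_le_of_cover hδ hd hT hz
        fun v hv h0 => hc (mem_iUnion₂.2 ⟨v, hv, h0⟩))
    have hB₁ : (lawBW (intensity ρ t δ)).real BAD₁ ≤ (T.card : ℝ) * Vb := by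
      calc (lawBW (intensity ρ t δ)).real BAD₁
          ≤ ∑ v ∈ T, (lawBW (intensity ρ t δ)).real {c : PointConfig ℂ × PointConfig ℂ |
              c.1.count (ball (v / (δ : ℂ)) (d₀ / (2 * δ))) = 0} :=
            measureReal_biUnion_finset_le T _
        _ ≤ ∑ v ∈ T, Vb := Finset.sum_le_sum fun v _ => by
            rw [lawBW_real_countFst_eq_zero hP measurableSet_ball (hfin v)]
            exact hvoid v
        _ = (T.card : ℝ) * Vb := by rw [Finset.sum_const, nsmul_eq_mul]
    have hB₂ : (lawBW (intensity ρ t δ)).real BAD₂ ≤ (T.card : ℝ) * Vb := by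
      calc (lawBW (intensity ρ t δ)).real BAD₂
          ≤ ∑ v ∈ T, (lawBW (intensity ρ t δ)).real {c : PointConfig ℂ × PointConfig ℂ |
              c.2.count (ball (v / (δ : ℂ)) (d₀ / (2 * δ))) = 0} :=
            measureReal_biUnion_finset_le T _
        _ ≤ ∑ v ∈ T, Vb := Finset.sum_le_sum fun v _ => by
            rw [lawBW_real_countSnd_eq_zero hP measurableSet_ball (hfin v)]
            exact hvoid v
        _ = (T.card : ℝ) * Vb := by rw [Finset.sum_const, nsmul_eq_mul]
    have h1 := abs_measureReal_sub_le_of_iff (lawBW (intensity ρ t δ))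
      {c : PointConfig ℂ × PointConfig ℂ | (insertAt z c.1, c.2) ∈ crossEvent R δ}
      (crossEvent R δ) BAD₁ hgood₁
    have h2 := abs_measureReal_sub_le_of_iff (lawBW (intensity ρ t δ))
      {c : PointConfig ℂ × PointConfig ℂ | (c.1, insertAt z c.2) ∈ crossEvent R δ}
      (crossEvent R δ) BAD₂ hgood₂
    have hsplit : insResp ρ t R δ z =
        ((lawBW (intensity ρ t δ)).real
            {c : PointConfig ℂ × PointConfig ℂ | (insertAt z c.1, c.2) ∈ crossEvent R δ}
          - (lawBW (intensity ρ t δ)).real (crossEvent R δ)) +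
        ((lawBW (intensity ρ t δ)).real
            {c : PointConfig ℂ × PointConfig ℂ | (c.1, insertAt z c.2) ∈ crossEvent R δ}
          - (lawBW (intensity ρ t δ)).real (crossEvent R δ)) := by
      unfold insResp crossProb
      ring
    rw [hsplit]
    calc _ ≤ |(lawBW (intensity ρ t δ)).real
                {c : PointConfig ℂ × PointConfig ℂ | (insertAt z c.1, c.2) ∈ crossEvent R δ}
              - (lawBW (intensity ρ t δ)).real (crossEvent R δ)| +
            |(lawBW (intensity ρ t δ)).real
                {c : PointConfig ℂ × PointConfig ℂ | (c.1, insertAt z c.2) ∈ crossEvent R δ}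
              - (lawBW (intensity ρ t δ)).real (crossEvent R δ)| := abs_add_le _ _
      _ ≤ (lawBW (intensity ρ t δ)).real BAD₁ + (lawBW (intensity ρ t δ)).real BAD₂ :=
          add_le_add h1 h2
      _ ≤ (T.card : ℝ) * Vb + (T.card : ℝ) * Vb := add_le_add hB₁ hB₂
      _ = P := by rw [hPdef]; ring
  -- the integral
  have hpt : ∀ z : ℂ, ‖w ((δ : ℂ) * z) * insResp ρ t R δ z‖ ≤ P * |w ((δ : ℂ) * z)| := by
    intro z
    rw [Real.norm_eq_abs, abs_mul]
    by_cases hz : (δ : ℂ) * z ∈ tsupport w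
    · rw [mul_comm]
      exact mul_le_mul_of_nonneg_right (hins z hz) (abs_nonneg _)
    · rw [image_eq_zero_of_notMem_tsupport hz]
      simp
  have hwδ : Integrable (fun z : ℂ => w ((δ : ℂ) * z)) :=
    (hw.1.continuous.comp (continuous_const.mul continuous_id)).integrable_of_hasCompactSupport
      (hasCompactSupport_comp_mul hw.2 hδne)
  have hint : Integrable (fun z : ℂ => P * |w ((δ : ℂ) * z)|) := hwδ.abs.const_mul P
  have hcov : ∫ z : ℂ, |w ((δ : ℂ) * z)| = (δ ^ 2)⁻¹ * I := by
    have h := Measure.integral_comp_smul (volume : Measure ℂ) (fun y => |w y|) δ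
    simp only [Complex.real_smul] at h
    rw [h, Complex.finrank_real_complex, smul_eq_mul, abs_of_pos (inv_pos.2 (pow_pos hδ 2))]
  calc |∫ z, w ((δ : ℂ) * z) * insResp ρ t R δ z|
      = ‖∫ z, w ((δ : ℂ) * z) * insResp ρ t R δ z‖ := (Real.norm_eq_abs _).symm
    _ ≤ ∫ z, P * |w ((δ : ℂ) * z)| := norm_integral_le_of_norm_le hint (Eventually.of_forall hpt)
    _ = P * ∫ z, |w ((δ : ℂ) * z)| := integral_const_mul _ _
    _ = P * ((δ ^ 2)⁻¹ * I) := by rw [hcov]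
    _ = C * δ ^ 2 := by
        rw [hPdef, hVbdef, hCdef]
        field_simp
        ring
    _ ≤ ε := hηC δ hδ hδη

end Summit.CriticalPhenomena.CardyFormulaZ2.Cruxes.VoronoiHubFromSmirnov.MoebiusExactDelaunayDilationWard

end
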